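import Summits.ValiantsHypothesis.ValiantsHypothesis.Theses.RealTau
import Literature.Computability.AlgebraicComplexity.RealTauKnownCases

/-!
# `RealTau.TauReal` (stmt-ValiantsHypothesis-0358) — probes, load-bearing hypotheses, shape of the bound

Negative knowledge for the crux `Summit.ValiantsHypothesis.ValiantsHypothesis.Theses.RealTau.TauReal`
(Koiran's real τ-conjecture, shared by signature with `TauConst.TauReal`), from the birth crux-attack
(refuter, 2026-08-17).  Nothing here refutes the crux — it is Koiran 2011 §6 Conj. 3, OPEN — but every
cheap mutation of it is settled:

* §0 `tauReal_iff_koiran` — the crux is, by `Iff.rfl`, the Literature conjecture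
  `KoiranRealTauConjecture`; `tauReal_iff_dropNeZero` — the hypothesis `F ≠ 0` is redundant in Lean
  (`Polynomial.roots 0 = 0`), so provers may ignore it and refuters gain nothing from `F = 0`.
* §1 degenerate corners are harmless: `k = 0` or (`t = 0`, `0 < m`) force `F = 0` (excluded /
  rootless), `m = 0` makes `F` the constant `k` (no roots).
* §2 load-bearing: `tauReal_false_without_sparsity` (drop `#supp f_ij ≤ t`: one dense factor),
  `not_tauRealMultiplicity` (count roots WITH multiplicity: `X^n`, `k = m = t = 1`),
  `not_tauRealComplex` (distinct roots over `ℂ`: `X^n - 1`, `k = m = 1`, `t = 2`) — any proof must use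
  sparsity, distinctness and the order of `ℝ`.
* §3 shape of the bound: none of `k`, `m`, `t` can be dropped from the base (`not_tauRealBoundNoK`,
  `not_tauRealBoundNoM`, `not_tauRealBoundNoT`), and the exponent `c = 1` is too small
  (`not_tauRealBound_exp_one`: `k = 1`, `m = 2`, `t = 3`, nine real zeros `0, ±1, ±2, ±3, ±4` of
  `(X⁴ - 5X² + 4)(X⁵ - 25X³ + 144X)` against `1 + 2 + 3 + 2 = 8`); `c = 2` is consistent with everything
  known (`koiranRealTauConjecture_of_k_le_one` has exponent 2; no ΣΠ-sparse family with more than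
  `O(k + mt)` distinct real zeros is known).
[folklore]
-/

namespace Summit.ValiantsHypothesis.ValiantsHypothesis.Theorems.TauReal.Negative

open scoped BigOperators
open Polynomial Finset
open Summit.ValiantsHypothesis.ValiantsHypothesis.Theses.RealTau (TauReal)

noncomputable section

/-! ## §0 The crux by name; the redundant hypothesis `F ≠ 0` -/

/-- The crux is literally Koiran's real τ-conjecture as registered in the Literature. -/
theorem tauReal_iff_koiran :
    TauReal ↔ Literature.Computability.AlgebraicComplexity.KoiranRealTauConjecture :=
  Iff.rfl

/-- The crux with the hypothesis `F ≠ 0` deleted. -/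
def TauRealDropNeZero : Prop :=
  ∃ c : ℕ, ∀ (k m t : ℕ) (f : Fin k → Fin m → ℝ[X]), (∀ i j, (f i j).support.card ≤ t) →
    (∑ i, ∏ j, f i j).roots.toFinset.card ≤ (k + m + t + 2) ^ c

/-- `F ≠ 0` is decoration in Lean: `roots 0 = 0`, so the zero polynomial has no "roots" to count. -/
theorem tauReal_iff_dropNeZero : TauReal ↔ TauRealDropNeZero := by
  constructor
  · rintro ⟨c, hc⟩
    refine ⟨c, fun k m t f hf => ?_⟩
    by_cases hF : (∑ i, ∏ j, f i j) = 0
    · rw [hF, roots_zero, Multiset.toFinset_zero, card_empty]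
      exact Nat.zero_le _
    · exact hc k m t f hf hF
  · rintro ⟨c, hc⟩
    exact ⟨c, fun k m t f hf _ => hc k m t f hf⟩

/-! ## §1 Degenerate corners (no junk case) -/

/-- `k = 0`: the sum is `0` (excluded by `F ≠ 0`, rootless anyway). -/
theorem sum_prod_eq_zero_of_k_eq_zero (m : ℕ) (f : Fin 0 → Fin m → ℝ[X]) :
    (∑ i, ∏ j, f i j) = 0 := by
  simp

/-- `m = 0`: every product is `1`, `F` is the constant `k` and has no roots. -/
theorem card_roots_of_m_eq_zero (k : ℕ) (f : Fin k → Fin 0 → ℝ[X]) :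
    (∑ i, ∏ j, f i j).roots.toFinset.card = 0 := by
  have h : (∑ i : Fin k, ∏ j : Fin 0, f i j) = C (k : ℝ) := by simp
  rw [h, roots_C, Multiset.toFinset_zero, card_empty]

/-- `t = 0` with `0 < m`: every factor is `0`, so `F = 0` (excluded). -/
theorem sum_prod_eq_zero_of_t_eq_zero {k m : ℕ} (hm : 0 < m) (f : Fin k → Fin m → ℝ[X])
    (hf : ∀ i j, (f i j).support.card ≤ 0) : (∑ i, ∏ j, f i j) = 0 := by
  have h0 : ∀ i j, f i j = 0 := fun i j => by
    have h := Nat.le_zero.mp (hf i j)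
    rwa [card_eq_zero, support_eq_empty] at h
  exact sum_eq_zero fun i _ => prod_eq_zero (mem_univ (⟨0, hm⟩ : Fin m)) (h0 i _)

/-! ## §2 Load-bearing hypotheses: sparsity, distinctness, realness -/

/-- The crux with its sparsity hypothesis `∀ i j, #supp (f i j) ≤ t` DELETED (so `t` is free). -/
def TauRealWithoutSparsity : Prop :=
  ∃ c : ℕ, ∀ (k m t : ℕ) (f : Fin k → Fin m → ℝ[X]), (∑ i, ∏ j, f i j) ≠ 0 →
    (∑ i, ∏ j, f i j).roots.toFinset.card ≤ (k + m + t + 2) ^ c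

/-- A `Fin 1 × Fin 1` sum of products is its single entry. -/
theorem sum_prod_fin_one_one (g : ℝ[X]) : (∑ _i : Fin 1, ∏ _j : Fin 1, g) = g := by simp

/-- The dense witness `∏_{a < N} (X - a)`: nonzero, with exactly the `N` distinct roots `0, …, N-1`. -/
theorem card_roots_prod_X_sub_nat (N : ℕ) :
    (((range N).image (Nat.cast : ℕ → ℝ)).prod fun a => X - C a).roots.toFinset.card = N := by
  rw [roots_prod_X_sub_C, Finset.val_toFinset, card_image_of_injective _ Nat.cast_injective,
    card_range]

/-- The dense witness is monic, hence nonzero. -/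
theorem prod_X_sub_nat_ne_zero (N : ℕ) :
    (((range N).image (Nat.cast : ℕ → ℝ)).prod fun a => X - C a) ≠ 0 :=
  (monic_prod_of_monic _ _ fun a _ => monic_X_sub_C a).ne_zero

/-- **Load-bearing: any proof must use the sparsity hypothesis.**  Without it take `k = m = 1`,
`t = 0` and the single dense factor `∏_{a < 4^c + 1} (X - a)`: `4^c + 1` roots against `4^c`. -/
theorem tauReal_false_without_sparsity : ¬ TauRealWithoutSparsity := by
  rintro ⟨c, h⟩
  set N := 4 ^ c + 1 with hN
  have hle := h 1 1 0 (fun _ _ => ((range N).image (Nat.cast : ℕ → ℝ)).prod fun a => X - C a)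
    (by rw [sum_prod_fin_one_one]; exact prod_X_sub_nat_ne_zero N)
  rw [sum_prod_fin_one_one, card_roots_prod_X_sub_nat] at hle
  norm_num at hle
  omega

/-- The crux with roots counted WITH multiplicity (`roots.card` for `roots.toFinset.card`). -/
def TauRealMultiplicity : Prop :=
  ∃ c : ℕ, ∀ (k m t : ℕ) (f : Fin k → Fin m → ℝ[X]), (∀ i j, (f i j).support.card ≤ t) →
    (∑ i, ∏ j, f i j) ≠ 0 → Multiset.card (∑ i, ∏ j, f i j).roots ≤ (k + m + t + 2) ^ c

/-- **Distinctness is load-bearing**: `X^n` (`k = m = t = 1`) has the root `0` with multiplicity `n`,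
unbounded against `5^c`. -/
theorem not_tauRealMultiplicity : ¬ TauRealMultiplicity := by
  rintro ⟨c, h⟩
  set n := 5 ^ c + 1 with hn
  have hle := h 1 1 1 (fun _ _ => X ^ n) (fun _ _ => by rw [support_X_pow]; simp)
    (by rw [sum_prod_fin_one_one]; exact pow_ne_zero n X_ne_zero)
  rw [sum_prod_fin_one_one, roots_X_pow] at hle
  simp at hle
  omega

/-- The crux over `ℂ` (distinct complex roots of a ΣΠ of `t`-sparse complex polynomials). -/
def TauRealComplex : Prop :=
  ∃ c : ℕ, ∀ (k m t : ℕ) (f : Fin k → Fin m → ℂ[X]), (∀ i j, (f i j).support.card ≤ t) →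
    (∑ i, ∏ j, f i j) ≠ 0 → (∑ i, ∏ j, f i j).roots.toFinset.card ≤ (k + m + t + 2) ^ c

/-- A `Fin 1 × Fin 1` sum of products is its single entry (complex copy). -/
theorem sum_prod_fin_one_one' (g : ℂ[X]) : (∑ _i : Fin 1, ∏ _j : Fin 1, g) = g := by simp

/-- **Realness is load-bearing**: over `ℂ` the binomial `X^n - 1` (`k = m = 1`, `t = 2`) has `n`
distinct roots, unbounded against `6^c` — so any proof must use the order of `ℝ` (Descartes, Rolle…),
exactly as the barrier `TauRealZeros` (Chebyshev) says for circuits. -/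
theorem not_tauRealComplex : ¬ TauRealComplex := by
  rintro ⟨c, h⟩
  obtain ⟨n, hn⟩ : ∃ n : ℕ, n = 6 ^ c + 1 := ⟨_, rfl⟩
  have hn0 : n ≠ 0 := by rw [hn]; exact Nat.succ_ne_zero _
  have hprim := Complex.isPrimitiveRoot_exp n hn0
  have hsupp : (X ^ n - 1 : ℂ[X]).support.card ≤ 2 := by
    have : (X ^ n - 1 : ℂ[X]) = C 1 * X ^ n + C (-1) * X ^ 0 := by simp; ring
    rw [this]
    exact (card_le_card (support_binomial_subset n 0 1 (-1))).trans (card_insert_le _ _)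
  have hne : (X ^ n - 1 : ℂ[X]) ≠ 0 :=
    (monic_X_pow_sub_C (1 : ℂ) hn0).ne_zero
  have hle := h 1 1 2 (fun _ _ => X ^ n - 1) (fun _ _ => hsupp)
    (by rw [sum_prod_fin_one_one']; exact hne)
  rw [sum_prod_fin_one_one'] at hle
  have hcard : (X ^ n - 1 : ℂ[X]).roots.toFinset.card = n := by
    classical
    have := hprim.card_nthRootsFinset
    rwa [nthRootsFinset_def, nthRoots, C_1] at this
  rw [hcard] at hle
  have h6 : (1 + 1 + 2 + 2) ^ c = 6 ^ c := by norm_num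
  rw [h6] at hle
  omega

/-! ## §3 Shape of the bound: `k`, `m`, `t` all enter; exponent `1` is too small -/

/-- The bound with the `k`-dependence removed. -/
def TauRealBoundNoK : Prop :=
  ∃ c : ℕ, ∀ (k m t : ℕ) (f : Fin k → Fin m → ℝ[X]), (∀ i j, (f i j).support.card ≤ t) →
    (∑ i, ∏ j, f i j) ≠ 0 → (∑ i, ∏ j, f i j).roots.toFinset.card ≤ (m + t + 2) ^ c

/-- The bound with the `m`-dependence removed. -/
def TauRealBoundNoM : Prop :=
  ∃ c : ℕ, ∀ (k m t : ℕ) (f : Fin k → Fin m → ℝ[X]), (∀ i j, (f i j).support.card ≤ t) →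
    (∑ i, ∏ j, f i j) ≠ 0 → (∑ i, ∏ j, f i j).roots.toFinset.card ≤ (k + t + 2) ^ c

/-- The bound with the `t`-dependence removed. -/
def TauRealBoundNoT : Prop :=
  ∃ c : ℕ, ∀ (k m t : ℕ) (f : Fin k → Fin m → ℝ[X]), (∀ i j, (f i j).support.card ≤ t) →
    (∑ i, ∏ j, f i j) ≠ 0 → (∑ i, ∏ j, f i j).roots.toFinset.card ≤ (k + m + 2) ^ c

/-- **`t` enters the bound**: `k = m = 1`, one dense factor `∏_{a<N}(X - a)` is `(N+1)`-sparse with `N`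
roots, unbounded against `4^c`. -/
theorem not_tauRealBoundNoT : ¬ TauRealBoundNoT := by
  rintro ⟨c, h⟩
  set N := 4 ^ c + 1 with hN
  set P : ℝ[X] := ((range N).image (Nat.cast : ℕ → ℝ)).prod fun a => X - C a with hP
  have hle := h 1 1 (P.natDegree + 1) (fun _ _ => P) (fun _ _ => card_supp_le_succ_natDegree _)
    (by rw [sum_prod_fin_one_one]; exact prod_X_sub_nat_ne_zero N)
  rw [sum_prod_fin_one_one, hP, card_roots_prod_X_sub_nat] at hle
  norm_num at hle
  omega

/-- **`m` enters the bound**: `k = 1`, `t = 2`, the `m` binomial factors `X - j` (`j < m`) give `m`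
distinct roots, unbounded against `5^c`. -/
theorem not_tauRealBoundNoM : ¬ TauRealBoundNoM := by
  rintro ⟨c, h⟩
  obtain ⟨m, hm⟩ : ∃ m : ℕ, m = 5 ^ c + 1 := ⟨_, rfl⟩
  have hsupp : ∀ j : Fin m, (X - C ((j : ℕ) : ℝ) : ℝ[X]).support.card ≤ 2 := fun j => by
    have : (X - C ((j : ℕ) : ℝ) : ℝ[X]) = C 1 * X ^ 1 + C (-((j : ℕ) : ℝ)) * X ^ 0 := by simp; ring
    rw [this]
    exact (card_le_card (support_binomial_subset 1 0 _ _)).trans (card_insert_le _ _)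
  have hprod : (∑ _i : Fin 1, ∏ j : Fin m, (X - C ((j : ℕ) : ℝ) : ℝ[X])) =
      ((range m).image (Nat.cast : ℕ → ℝ)).prod fun a => X - C a := by
    rw [Fin.sum_univ_one, prod_image fun a _ b _ h => Nat.cast_injective h,
      ← Fin.prod_univ_eq_prod_range (fun j => (X - C ((j : ℕ) : ℝ) : ℝ[X])) m]
  have hle := h 1 m 2 (fun _ j => X - C ((j : ℕ) : ℝ)) (fun _ j => hsupp j)
    (by rw [hprod]; exact prod_X_sub_nat_ne_zero m)
  rw [hprod, card_roots_prod_X_sub_nat] at hle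
  have h5 : (1 + 2 + 2) ^ c = 5 ^ c := by norm_num
  rw [h5] at hle
  omega

/-- **`k` enters the bound**: `m = t = 1`, the `k = N + 1` monomials `coeff_i · X^i` of the dense
`∏_{a<N}(X - a)` (one per summand) sum back to it: `N` roots, unbounded against `4^c`. -/
theorem not_tauRealBoundNoK : ¬ TauRealBoundNoK := by
  rintro ⟨c, h⟩
  set N := 4 ^ c + 1 with hN
  set P : ℝ[X] := ((range N).image (Nat.cast : ℕ → ℝ)).prod fun a => X - C a with hP
  have hsum : (∑ i : Fin (P.natDegree + 1), ∏ _j : Fin 1, C (P.coeff (i : ℕ)) * X ^ (i : ℕ)) = P := by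
    simp only [Finset.prod_const, Finset.card_univ, Fintype.card_fin, pow_one]
    rw [Fin.sum_univ_eq_sum_range (fun i => C (P.coeff i) * X ^ i) (P.natDegree + 1)]
    exact P.as_sum_range_C_mul_X_pow.symm
  have hle := h (P.natDegree + 1) 1 1 (fun i _ => C (P.coeff (i : ℕ)) * X ^ (i : ℕ))
    (fun i _ => card_support_C_mul_X_pow_le_one) (by rw [hsum]; exact prod_X_sub_nat_ne_zero N)
  rw [hsum, hP, card_roots_prod_X_sub_nat] at hle
  norm_num at hle
  omega

/-- The crux at a FIXED exponent `c`. -/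
def TauRealBoundExp (c : ℕ) : Prop :=
  ∀ (k m t : ℕ) (f : Fin k → Fin m → ℝ[X]), (∀ i j, (f i j).support.card ≤ t) →
    (∑ i, ∏ j, f i j) ≠ 0 → (∑ i, ∏ j, f i j).roots.toFinset.card ≤ (k + m + t + 2) ^ c

/-- The crux is `∃ c, TauRealBoundExp c` (by `Iff.rfl`). -/
theorem tauReal_iff_exists_exp : TauReal ↔ ∃ c, TauRealBoundExp c := Iff.rfl

/-- First witness factor `X⁴ - 5X² + 4 = (X² - 1)(X² - 4)` (3-sparse). -/
def qA : ℝ[X] := C 4 * X ^ 0 + C (-5) * X ^ 2 + C 1 * X ^ 4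

/-- Second witness factor `X⁵ - 25X³ + 144X = X(X² - 9)(X² - 16)` (3-sparse). -/
def qB : ℝ[X] := C 144 * X ^ 1 + C (-25) * X ^ 3 + C 1 * X ^ 5

/-- `qA` is 3-sparse. -/
theorem card_support_qA : qA.support.card ≤ 3 :=
  (card_le_card (support_trinomial_subset 0 2 4 _ _ _)).trans
    ((card_insert_le _ _).trans (Nat.succ_le_succ ((card_insert_le _ _).trans (by simp))))

/-- `qB` is 3-sparse. -/
theorem card_support_qB : qB.support.card ≤ 3 :=
  (card_le_card (support_trinomial_subset 1 3 5 _ _ _)).trans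
    ((card_insert_le _ _).trans (Nat.succ_le_succ ((card_insert_le _ _).trans (by simp))))

/-- The witness `k = 1`, `m = 2`, `t = 3`. -/
def wit : Fin 1 → Fin 2 → ℝ[X] := fun _ j => if j = 0 then qA else qB

/-- The ΣΠ-expression of the witness is `qA * qB`. -/
theorem sum_prod_wit : (∑ i, ∏ j, wit i j) = qA * qB := by
  simp [wit, Fin.prod_univ_two]

/-- `qA ≠ 0` (its `X⁴` coefficient is `1`). -/
theorem qA_ne_zero : qA ≠ 0 := fun h => by
  have := congrArg (fun p : ℝ[X] => p.coeff 4) h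
  simp [qA, coeff_X_pow, coeff_C_mul] at this

/-- `qB ≠ 0` (its `X⁵` coefficient is `1`). -/
theorem qB_ne_zero : qB ≠ 0 := fun h => by
  have := congrArg (fun p : ℝ[X] => p.coeff 5) h
  simp [qB, coeff_X_pow, coeff_C_mul] at this

/-- The nine reals `0, ±1, ±2, ±3, ±4` are roots of `qA * qB`. -/
theorem roots_wit : ({0, 1, -1, 2, -2, 3, -3, 4, -4} : Finset ℝ) ⊆ (qA * qB).roots.toFinset := by
  intro x hx
  rw [Multiset.mem_toFinset, mem_roots (mul_ne_zero qA_ne_zero qB_ne_zero), IsRoot.def, eval_mul]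
  simp only [mem_insert, mem_singleton] at hx
  rcases hx with rfl | rfl | rfl | rfl | rfl | rfl | rfl | rfl | rfl <;> norm_num [qA, qB]

/-- **Exponent `1` is too small**: `qA * qB` (`k = 1`, `m = 2`, `t = 3`) has the nine distinct real
zeros `0, ±1, ±2, ±3, ±4`, more than `(1 + 2 + 3 + 2)^1 = 8`.  (Exponent `2` survives everything known.) -/
theorem not_tauRealBound_exp_one : ¬ TauRealBoundExp 1 := by
  intro h
  have hle := h 1 2 3 wit (fun i j => by
    fin_cases j
    · simpa [wit] using card_support_qA
    · simpa [wit] using card_support_qB)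
    (by rw [sum_prod_wit]; exact mul_ne_zero qA_ne_zero qB_ne_zero)
  rw [sum_prod_wit] at hle
  have h9 : 9 ≤ (qA * qB).roots.toFinset.card := by
    have := card_le_card roots_wit
    have h9' : ({0, 1, -1, 2, -2, 3, -3, 4, -4} : Finset ℝ).card = 9 := by
      norm_num [card_insert_of_notMem]
    omega
  norm_num at hle
  omega

/-- Hence the crux cannot hold with exponent `0` or `1`: any `c` in `TauReal` is at least `2`. -/
theorem two_le_of_tauRealBoundExp {c : ℕ} (hc : TauRealBoundExp c) : 2 ≤ c := by
  by_contra hlt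
  have hmono : TauRealBoundExp 1 := fun k m t f hf hF =>
    (hc k m t f hf hF).trans (Nat.pow_le_pow_right (by omega) (by omega))
  exact not_tauRealBound_exp_one hmono

end

end Summit.ValiantsHypothesis.ValiantsHypothesis.Theorems.TauReal.Negative
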